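import Summits.CriticalPhenomena.Ising3DConformalLimit.Theses.FKParityRobustness
import Literature.Probability.LatticeModels.WeightedCurrents
import Literature.Probability.LatticeModels.IsingTransport
import Literature.Probability.LatticeModels.CriticalCorrWellDefined
import Summits.CriticalPhenomena.Ising3DConformalLimit.Theorems.FKParityRobustnessParityBoundCurrents

/-!
# `LatticeBoundFromStrands` (route `FKParityRobustness`, item `stmt-CriticalPhenomena-14648`)

Support (glue) item of the sub-problem `Ising3DConformalLimit`:
`IndependentStrandsJoin → [StrandsJoinBound, inlined] → ∃ c > 0, ∀ l ≥ 1,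
U₄^crit(l·tetra) ≤ -c·⟨σ_{a₀}σ_{a₁}⟩_{β_c}⟨σ_{a₂}σ_{a₃}⟩_{β_c}` at the dilated tetrahedron
`A_l = l·{(−1,−1,−1),(1,1,−1),(1,−1,1),(−1,1,1)} ⊂ ℤ³`.

**Proof.** Fix `l ≥ 1`; `IndependentStrandsJoin` gives `c > 0` and `N₀(l)` with
`c·Z_N(a₀a₁)·Z_N(a₂a₃) ≤ J_N` (the joint loop-O(1) sum) on the induced box graph
`G_N = (zdGraph 3).comap Subtype.val` on `↥(box 3 N)` for `N ≥ N₀`; the inlined `StrandsJoinBound` gives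
`U₄^free_{G_N}(a)·(Z⁰_N)² ≤ -2 J_N`. Dividing by `(Z⁰_N)² > 0` and using `⟨σ_xσ_y⟩^free_{G_N} = Z^{xy}_N / Z⁰_N`
(high-temperature expansion, here through the random-current representation
`isingTwoPoint_free_eq_currentSum_div_holds` and the odd-part pushforward
`tsum_sources_eweight_mul_apply_oddPart`: `Z_β[A] = cosh(β)^{|E|}·Z^A_{tanh β}`) gives
`U₄^free_{G_N}(a) ≤ -2c·⟨σσ⟩⟨σσ⟩` on `G_N`. The free Ising measure of the induced graph has the same spin
moments as the free finite-volume measure `isingMeasure (zdGraph 3) (box 3 N) β 0 .free`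
(`isingExpect_free_map`), and the seven free box limits converge to `criticalCorr 3 _ _`
(`criticalCorr_wellDefined_holds`, `d = 3`), so the inequality passes to the limit `N → ∞` (closed
condition). The constant is `2c`.

Adapted from the candidate file `Cruxes/JoinForcesU4/CandidateProof_JoinForcesU4.lean` (step (B)) filed as
evidence on this item by the crux-ideation planner of `JoinForcesU4`.

## References

* M. Aizenman, *Geometric analysis of φ⁴ fields and Ising models*, Comm. Math. Phys. 86 (1982), Prop. 5.3
  [AizenmanCMP1982].
* S. Friedli, Y. Velenik, *Statistical Mechanics of Lattice Systems*, CUP 2017, §3.1, §3.7.3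
  (free-measure transport; high-temperature expansion `⟨σ_xσ_y⟩ = Z^{xy}/Z^∅`) [FriedliVelenik2017].
* M. Aizenman, H. Duminil-Copin, V. Sidoravicius, Comm. Math. Phys. 334 (2015) (continuity at `β_c`,
  behind `criticalCorr_wellDefined_holds`) [AizenmanDuminilCopinSidoraviciusCMP2015].
-/

namespace Summit.CriticalPhenomena.Ising3DConformalLimit.FKParityRobustnessLatticeBoundFromStrands

open scoped BigOperators symmDiff ENNReal Topology
open Finset Filter Literature.Probability.LatticeModels
open Summit.CriticalPhenomena.Ising3DConformalLimit.Theses.FKParityRobustness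

noncomputable section

/-! ### Transport: induced box graph versus free finite-volume measure -/

/-- TRANSPORT of `n`-point functions (template: `wickDeviation_le_box` of `AizenmanWickBound.lean`):
the free Ising measure of the graph INDUCED on a volume `Λ ⊂ ℤ^d` (the route's
`(zdGraph 3).comap Subtype.val` on `↥(box 3 N)`) has the same spin moments as the free finite-volume
measure `⟨·⟩^∅_{Λ}` of `ℤ^d` (`isingMeasure (zdGraph d) Λ β 0 .free`), whose box limits
`criticalCorr_wellDefined_holds` controls. Via `isingExpect_free_map` along the embedding `Λ ↪ ℤ^d`
(Friedli–Velenik 2017, §3.1: the free Hamiltonian only sees edges inside `Λ`). -/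
theorem nPoint_boxComap {d : ℕ} (Λ : Finset (Site d)) (β : ℝ) {m : ℕ} (y : Fin m → ↥Λ) :
    nPoint (isingMeasure ((zdGraph d).comap (Subtype.val : ↥Λ → Site d)) univ β 0 .free) spinAt y =
      nPoint (isingMeasure (zdGraph d) Λ β 0 .free) spinAt (fun i => (y i : Site d)) := by
  classical
  set ι : ↥Λ ↪ Site d := Function.Embedding.subtype (· ∈ Λ) with hι
  have hmap : (univ : Finset ↥Λ).map ι = Λ := by
    rw [hι, Finset.univ_eq_attach, Finset.attach_map_val]
  have hadj : ∀ a ∈ (univ : Finset ↥Λ), ∀ b ∈ (univ : Finset ↥Λ),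
      ((zdGraph d).Adj (ι a) (ι b) ↔ ((zdGraph d).comap (Subtype.val : ↥Λ → Site d)).Adj a b) :=
    fun _ _ _ _ => Iff.rfl
  have key := isingExpect_free_map (G := (zdGraph d).comap (Subtype.val : ↥Λ → Site d))
    (G' := zdGraph d) ι (Λ := univ) hadj β 0 (measurable_spinMonomial fun i => (y i : Site d))
  rw [hmap] at key
  change isingExpect _ univ β 0 .free (spinMonomial y) =
    isingExpect (zdGraph d) Λ β 0 .free (spinMonomial fun i => (y i : Site d))
  rw [key]
  congr 1
  funext σ
  simp only [spinMonomial]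
  exact Finset.prod_congr rfl fun i _ => (spinAt_extendAlong ι σ (y i)).symm

/-- TRANSPORT of the two-point function from the induced graph on `Λ` to the free finite-volume
measure of `ℤ^d` in `Λ` (`isingTwoPoint_free_map`). -/
theorem twoPoint_boxComap {d : ℕ} (Λ : Finset (Site d)) (β : ℝ) (a b : ↥Λ) :
    twoPoint (isingMeasure ((zdGraph d).comap (Subtype.val : ↥Λ → Site d)) univ β 0 .free) spinAt a b =
      twoPoint (isingMeasure (zdGraph d) Λ β 0 .free) spinAt (a : Site d) b := by
  classical
  set ι : ↥Λ ↪ Site d := Function.Embedding.subtype (· ∈ Λ) with hι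
  have hmap : (univ : Finset ↥Λ).map ι = Λ := by
    rw [hι, Finset.univ_eq_attach, Finset.attach_map_val]
  have hadj : ∀ a ∈ (univ : Finset ↥Λ), ∀ b ∈ (univ : Finset ↥Λ),
      ((zdGraph d).Adj (ι a) (ι b) ↔ ((zdGraph d).comap (Subtype.val : ↥Λ → Site d)).Adj a b) :=
    fun _ _ _ _ => Iff.rfl
  have key := isingTwoPoint_free_map (G := (zdGraph d).comap (Subtype.val : ↥Λ → Site d))
    (G' := zdGraph d) ι (Λ := univ) hadj β 0 a b
  rw [hmap] at key
  rw [twoPoint_isingMeasure, twoPoint_isingMeasure]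
  exact key.symm

/-- TRANSPORT of the whole Ursell combination `U₄ = ⟨σσσσ⟩ - Σ ⟨σσ⟩⟨σσ⟩` (`connectedFour`) from the
induced graph on `Λ` to the free finite-volume measure of `ℤ^d` in `Λ`. -/
theorem connectedFour_boxComap {d : ℕ} (Λ : Finset (Site d)) (β : ℝ) (a : Fin 4 → ↥Λ) :
    connectedFour (isingMeasure ((zdGraph d).comap (Subtype.val : ↥Λ → Site d)) univ β 0 .free) spinAt a =
      connectedFour (isingMeasure (zdGraph d) Λ β 0 .free) spinAt (fun i => (a i : Site d)) := by
  simp only [connectedFour, nPoint_boxComap, twoPoint_boxComap]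

/-- CLOSED CONE: the defect inequality `u - (g₀₁g₂₃ + g₀₂g₁₃ + g₀₃g₁₂) ≤ -c·g₀₁g₂₃` is a closed
condition, so it passes from an eventually-true family along a non-trivial filter to the limits of
`u` and of the six pair entries `g · i j`, `i < j` (the diagonal entries are unconstrained).
[folklore] -/
theorem tetraDefect_le_of_tendsto' {ι : Type*} {l : Filter ι} [l.NeBot] {c u₀ : ℝ} {u : ι → ℝ}
    {g : ι → Fin 4 → Fin 4 → ℝ} {g₀ : Fin 4 → Fin 4 → ℝ}
    (hu : Tendsto u l (𝓝 u₀))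
    (h01 : Tendsto (fun n => g n 0 1) l (𝓝 (g₀ 0 1))) (h23 : Tendsto (fun n => g n 2 3) l (𝓝 (g₀ 2 3)))
    (h02 : Tendsto (fun n => g n 0 2) l (𝓝 (g₀ 0 2))) (h13 : Tendsto (fun n => g n 1 3) l (𝓝 (g₀ 1 3)))
    (h03 : Tendsto (fun n => g n 0 3) l (𝓝 (g₀ 0 3))) (h12 : Tendsto (fun n => g n 1 2) l (𝓝 (g₀ 1 2)))
    (h : ∀ᶠ n in l, u n - (g n 0 1 * g n 2 3 + g n 0 2 * g n 1 3 + g n 0 3 * g n 1 2) ≤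
      -(c * (g n 0 1 * g n 2 3))) :
    u₀ - (g₀ 0 1 * g₀ 2 3 + g₀ 0 2 * g₀ 1 3 + g₀ 0 3 * g₀ 1 2) ≤ -(c * (g₀ 0 1 * g₀ 2 3)) :=
  le_of_tendsto_of_tendsto
    (hu.sub (((h01.mul h23).add (h02.mul h13)).add (h03.mul h12)))
    ((h01.mul h23).const_mul c).neg h

/-! ### The tetrahedral shape `A = {(−1,−1,−1),(1,1,−1),(1,−1,1),(−1,1,1)} ⊂ ℤ³` -/

/-- The four vertices of the route's tetrahedron `A` (the literal of the route decl's `let tetra := …`)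
are distinct. [folklore] -/
theorem tetra_injective :
    Function.Injective (![![-1, -1, -1], ![1, 1, -1], ![1, -1, 1], ![-1, 1, 1]] : Fin 4 → Site 3) := by
  decide

/-- The dilated tetrahedron `l·A` sits in every box `Λ_N = {-N,…,N}³` of radius `N ≥ l`. -/
theorem smul_tetra_mem_box {l N : ℕ} (h : l ≤ N) (i : Fin 4) :
    (l : ℤ) • (![![-1, -1, -1], ![1, 1, -1], ![1, -1, 1], ![-1, 1, 1]] : Fin 4 → Site 3) i ∈ box 3 N := by
  rw [mem_box]
  intro k
  have hl : ((l : ℕ) : ℤ) ≤ N := by exact_mod_cast h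
  fin_cases i <;> fin_cases k <;> simp <;> omega

/-! ### High-temperature ratio `⟨σ_xσ_y⟩ = Z^{xy}/Z^∅` and the finite-graph algebra -/

section StepB

open scoped Classical

/-- `Z_β[A] = cosh(β)^{|E|} · Z^A_{tanh β}` for every source set `A`: the random-current partition
function with sources `A` at constant coupling `β ≥ 0` equals `cosh(β)^{|E|}` times the sourced
loop-O(1) (high-temperature) partition function at `t = tanh β` — the odd-part pushforward
`tsum_sources_eweight_mul_apply_oddPart` with test function `g ≡ 1` (generalises the landed
`ecurrentSum_empty_eq_ofReal`; Friedli–Velenik 2017, §3.7.3). -/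
theorem ecurrentSum_eq_ofReal_loopO1 {V : Type*} [Fintype V] [DecidableEq V] {G : SimpleGraph V}
    [DecidableRel G.Adj] {β : ℝ} (hβ : 0 ≤ β) (A : Finset V) :
    ecurrentSum (fun _ : G.edgeFinset => β) A =
      ENNReal.ofReal (Real.cosh β ^ #G.edgeFinset * loopO1PartitionFunction G (Real.tanh β) A) := by
  have ht : 0 ≤ Real.tanh β := by
    rw [Real.tanh_eq_sinh_div_cosh]
    exact div_nonneg (Real.sinh_nonneg_iff.2 hβ) (Real.cosh_pos β).le
  have h := Summit.CriticalPhenomena.Ising3DConformalLimit.Theorems.tsum_sources_eweight_mul_apply_oddPart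
    (G := G) hβ A (fun _ => 1)
  simp only [mul_one] at h
  unfold ecurrentSum
  rw [h]
  unfold loopO1PartitionFunction loopO1Weight
  rw [Finset.mul_sum, ENNReal.ofReal_sum_of_nonneg (fun F _ => by
    split_ifs
    · exact mul_nonneg (pow_nonneg (Real.cosh_pos β).le _) (pow_nonneg ht _)
    · rw [mul_zero])]
  refine Finset.sum_congr rfl fun F hF => ?_
  have hle : #F ≤ #G.edgeFinset := Finset.card_le_card (Finset.mem_powerset.1 hF)
  by_cases hc : (∀ v, Odd #(F.filter (v ∈ ·)) ↔ v ∈ A)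
  · have hc' : F ∈ tJoins G Set.univ A :=
      (mem_tJoins G).2 ⟨Finset.mem_powerset.1 hF, Set.subset_univ _, hc⟩
    rw [if_pos hc, if_pos hc',
      Summit.CriticalPhenomena.Ising3DConformalLimit.Theorems.sinh_pow_mul_cosh_pow_sub β hle]
  · have hc' : F ∉ tJoins G Set.univ A := fun h => hc ((mem_tJoins G).1 h).2.2
    rw [if_neg hc, if_neg hc', mul_zero, ENNReal.ofReal_zero]

/-- Free two-point function of a finite graph as a ratio of loop-O(1) partition functions:
`⟨σ_xσ_y⟩ = Z^{xy}_t / Z^∅_t`, `t = tanh β`, `x ≠ y`. -/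
theorem twoPoint_eq_loopO1_div {V : Type*} [Fintype V] [DecidableEq V] {G : SimpleGraph V}
    [DecidableRel G.Adj] {β : ℝ} (hβ : 0 ≤ β) {x y : V} (hxy : x ≠ y) :
    twoPoint (isingMeasure G Finset.univ β 0 .free) spinAt x y =
      loopO1PartitionFunction G (Real.tanh β) {x, y} / loopO1PartitionFunction G (Real.tanh β) ∅ := by
  have ht : 0 ≤ Real.tanh β := by
    rw [Real.tanh_eq_sinh_div_cosh]
    exact div_nonneg (Real.sinh_nonneg_iff.2 hβ) (Real.cosh_pos β).le
  have hK : ∀ _e : G.edgeFinset, 0 ≤ β := fun _ => hβ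
  have hcE : 0 < Real.cosh β ^ #G.edgeFinset := pow_pos (Real.cosh_pos β) _
  have hz : ∀ A : Finset V, wcurrentSum (fun _ : G.edgeFinset => β) A =
      Real.cosh β ^ #G.edgeFinset * loopO1PartitionFunction G (Real.tanh β) A := by
    intro A
    rw [← toReal_ecurrentSum hK, ecurrentSum_eq_ofReal_loopO1 hβ A, ENNReal.toReal_ofReal
      (mul_nonneg hcE.le (loopO1PartitionFunction_nonneg G ht A))]
  rw [twoPoint_isingMeasure, isingTwoPoint_free_eq_currentSum_div_holds G β x y,
    Current.symmDiff_singleton_eq_pair hxy, currentSum_eq_wcurrentSum, currentSum_eq_wcurrentSum, hz, hz,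
    mul_div_mul_left _ _ hcE.ne']

/-- The two-point function is the expectation of the two-point spin monomial. [folklore] -/
theorem twoPoint_eq_isingExpect_spinMonomial {V : Type*} [DecidableEq V] (G : SimpleGraph V)
    [DecidableRel G.Adj] [G.LocallyFinite] (Λ : Finset V) (β : ℝ) (x y : V) :
    twoPoint (isingMeasure G Λ β 0 .free) spinAt x y = isingExpect G Λ β 0 .free (spinMonomial ![x, y]) := by
  rw [← nPoint_isingMeasure]
  simp only [nPoint, twoPoint, Fin.prod_univ_two, Matrix.cons_val_zero, Matrix.cons_val_one]

/-- The finite-graph algebra: a joint-strand lower bound `c·Z^{a₀a₁}·Z^{a₂a₃} ≤ J` (the crux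
`IndependentStrandsJoin` in a box) and the inequality `U₄·(Z⁰)² ≤ -2J` (the inlined `StrandsJoinBound`)
give the defect inequality `U₄ ≤ -2c·⟨σ_{a₀}σ_{a₁}⟩⟨σ_{a₂}σ_{a₃}⟩`, dividing by `(Z⁰)² > 0` and using
`⟨σ_xσ_y⟩ = Z^{xy}/Z⁰` (`twoPoint_eq_loopO1_div`). -/
theorem defect_of_join {V : Type*} [Fintype V] [DecidableEq V] (G : SimpleGraph V) [DecidableRel G.Adj]
    {β c J : ℝ} (hβ : 0 ≤ β) (a : Fin 4 → V) (ha : Function.Injective a)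
    (hJ : c * loopO1PartitionFunction G (Real.tanh β) {a 0, a 1} *
      loopO1PartitionFunction G (Real.tanh β) {a 2, a 3} ≤ J)
    (hS : connectedFour (isingMeasure G Finset.univ β 0 .free) spinAt a *
      (loopO1PartitionFunction G (Real.tanh β) ∅) ^ 2 ≤ -(2 * J)) :
    connectedFour (isingMeasure G Finset.univ β 0 .free) spinAt a ≤
      -(2 * c * (twoPoint (isingMeasure G Finset.univ β 0 .free) spinAt (a 0) (a 1) *
        twoPoint (isingMeasure G Finset.univ β 0 .free) spinAt (a 2) (a 3))) := by
  have ht : 0 ≤ Real.tanh β := by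
    rw [Real.tanh_eq_sinh_div_cosh]
    exact div_nonneg (Real.sinh_nonneg_iff.2 hβ) (Real.cosh_pos β).le
  have hZ0 : 0 < loopO1PartitionFunction G (Real.tanh β) ∅ := loopO1PartitionFunction_empty_pos G ht
  have h2 : connectedFour (isingMeasure G Finset.univ β 0 .free) spinAt a *
      (loopO1PartitionFunction G (Real.tanh β) ∅) ^ 2 ≤
      -(2 * c * (loopO1PartitionFunction G (Real.tanh β) {a 0, a 1} *
        loopO1PartitionFunction G (Real.tanh β) {a 2, a 3})) := by linarith
  rw [twoPoint_eq_loopO1_div hβ (ha.ne (by decide)), twoPoint_eq_loopO1_div hβ (ha.ne (by decide)),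
    div_mul_div_comm, ← sq,
    show -(2 * c * (loopO1PartitionFunction G (Real.tanh β) {a 0, a 1} *
        loopO1PartitionFunction G (Real.tanh β) {a 2, a 3} / loopO1PartitionFunction G (Real.tanh β) ∅ ^ 2)) =
      -(2 * c * (loopO1PartitionFunction G (Real.tanh β) {a 0, a 1} *
        loopO1PartitionFunction G (Real.tanh β) {a 2, a 3})) / loopO1PartitionFunction G (Real.tanh β) ∅ ^ 2
      by ring,
    le_div_iff₀ (pow_pos hZ0 2)]
  exact h2

/-- **The lattice bound for a general shape.** Let `x : Fin 4 → ℤ³` be injective with dilates `l·x`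
inside the boxes `Λ_N`, `N ≥ l`. If two independent critical sourced loop-O(1) configurations in `Λ_N`
(sources `{l x₀, l x₁}` and `{l x₂, l x₃}`) join `l x₀` to `l x₂` with joint weight `≥ c·Z·Z` for all
large `N` (the shape of the crux `IndependentStrandsJoin`), and the finite-graph bound
`U₄·(Z⁰)² ≤ -2·JointSum` holds (the shape of `StrandsJoinBound`), then in the critical state
`U₄^crit(l·x) ≤ -2c·⟨σ_{lx₀}σ_{lx₁}⟩_{β_c}⟨σ_{lx₂}σ_{lx₃}⟩_{β_c}` for every `l ≥ 1`: the finite-volume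
defect inequality (`defect_of_join`) on the induced box graph, transported to the free box measure
(`connectedFour_boxComap`, `twoPoint_boxComap`), passes to the limit `N → ∞` through the seven free
box limits `criticalCorr_wellDefined_holds` (`d = 3`) and the closed cone `tetraDefect_le_of_tendsto'`. -/
theorem criticalDefect_le_of_join {c : ℝ} {x : Fin 4 → Site 3} (hx : Function.Injective x)
    (hbox : ∀ {l N : ℕ}, l ≤ N → ∀ i, (l : ℤ) • x i ∈ box 3 N)
    (hK : ∀ l : ℕ, 1 ≤ l → ∃ N₀ : ℕ, ∀ N : ℕ, N₀ ≤ N → ∀ a : Fin 4 → ↥(box 3 N),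
      (∀ i, ((a i : Site 3)) = (l : ℤ) • x i) →
        (let G := ((zdGraph 3).comap (Subtype.val : ↥(box 3 N) → Site 3));
         let t : ℝ := Real.tanh (criticalBeta 3);
         c * loopO1PartitionFunction G t {a 0, a 1} * loopO1PartitionFunction G t {a 2, a 3} ≤
           ∑ F₁ ∈ tJoins G Set.univ {a 0, a 1}, ∑ F₂ ∈ tJoins G Set.univ {a 2, a 3},
             if (SimpleGraph.fromEdgeSet ((↑F₁ : Set (Sym2 ↥(box 3 N))) ∪ ↑F₂)).Reachable (a 0) (a 2)
               then t ^ (F₁.card + F₂.card) else 0))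
    (hSJB : ∀ (V : Type) [Fintype V] [DecidableEq V] (G : SimpleGraph V) [DecidableRel G.Adj] (β : ℝ),
      0 ≤ β → ∀ a : Fin 4 → V, Function.Injective a →
        (let t : ℝ := Real.tanh β;
         connectedFour (isingMeasure G Finset.univ β 0 .free) spinAt a *
             (loopO1PartitionFunction G t ∅) ^ 2 ≤
           -(2 * ∑ F₁ ∈ tJoins G Set.univ {a 0, a 1}, ∑ F₂ ∈ tJoins G Set.univ {a 2, a 3},
             if (SimpleGraph.fromEdgeSet ((↑F₁ : Set (Sym2 V)) ∪ ↑F₂)).Reachable (a 0) (a 2)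
               then t ^ (F₁.card + F₂.card) else 0)))
    (l : ℕ) (hl : 1 ≤ l) :
    criticalCorr 3 4 (fun i => (l : ℤ) • x i) -
        (criticalCorr 3 2 ![(l : ℤ) • x 0, (l : ℤ) • x 1] * criticalCorr 3 2 ![(l : ℤ) • x 2, (l : ℤ) • x 3] +
          criticalCorr 3 2 ![(l : ℤ) • x 0, (l : ℤ) • x 2] * criticalCorr 3 2 ![(l : ℤ) • x 1, (l : ℤ) • x 3] +
          criticalCorr 3 2 ![(l : ℤ) • x 0, (l : ℤ) • x 3] * criticalCorr 3 2 ![(l : ℤ) • x 1, (l : ℤ) • x 2]) ≤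
      -(2 * c * (criticalCorr 3 2 ![(l : ℤ) • x 0, (l : ℤ) • x 1] *
        criticalCorr 3 2 ![(l : ℤ) • x 2, (l : ℤ) • x 3])) := by
  obtain ⟨N₀, hN⟩ := hK l hl
  have hl0 : ((l : ℕ) : ℤ) ≠ 0 := by exact_mod_cast (Nat.one_le_iff_ne_zero.1 hl)
  have hp : Function.Injective (fun i : Fin 4 => (l : ℤ) • x i) := fun i j h =>
    hx (smul_right_injective (Site 3) hl0 h)
  have hβ : 0 ≤ criticalBeta 3 := criticalBeta_nonneg 3
  -- the finite-volume inequality for `N ≥ max N₀ l`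
  have hfin : ∀ N : ℕ, max N₀ l ≤ N →
      isingExpect (zdGraph 3) (box 3 N) (criticalBeta 3) 0 .free (spinMonomial fun i : Fin 4 => (l : ℤ) • x i) -
          (isingExpect (zdGraph 3) (box 3 N) (criticalBeta 3) 0 .free (spinMonomial ![(l : ℤ) • x 0, (l : ℤ) • x 1]) *
              isingExpect (zdGraph 3) (box 3 N) (criticalBeta 3) 0 .free (spinMonomial ![(l : ℤ) • x 2, (l : ℤ) • x 3]) +
            isingExpect (zdGraph 3) (box 3 N) (criticalBeta 3) 0 .free (spinMonomial ![(l : ℤ) • x 0, (l : ℤ) • x 2]) *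
              isingExpect (zdGraph 3) (box 3 N) (criticalBeta 3) 0 .free (spinMonomial ![(l : ℤ) • x 1, (l : ℤ) • x 3]) +
            isingExpect (zdGraph 3) (box 3 N) (criticalBeta 3) 0 .free (spinMonomial ![(l : ℤ) • x 0, (l : ℤ) • x 3]) *
              isingExpect (zdGraph 3) (box 3 N) (criticalBeta 3) 0 .free (spinMonomial ![(l : ℤ) • x 1, (l : ℤ) • x 2])) ≤
        -(2 * c * (isingExpect (zdGraph 3) (box 3 N) (criticalBeta 3) 0 .free (spinMonomial ![(l : ℤ) • x 0, (l : ℤ) • x 1]) *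
          isingExpect (zdGraph 3) (box 3 N) (criticalBeta 3) 0 .free (spinMonomial ![(l : ℤ) • x 2, (l : ℤ) • x 3]))) := by
    intro N hNl
    have hN₀N : N₀ ≤ N := le_of_max_le_left hNl
    have hlN : l ≤ N := le_of_max_le_right hNl
    -- K1's configuration inside the box
    let a : Fin 4 → ↥(box 3 N) := fun i => ⟨(l : ℤ) • x i, hbox hlN i⟩
    have ha : ∀ i, ((a i : Site 3)) = (l : ℤ) • x i := fun i => rfl
    have hainj : Function.Injective a := fun i j h => hp (congrArg Subtype.val h)
    -- K1 at `N` and (A) on the induced graph, combined on the induced graph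
    have hU := defect_of_join ((zdGraph 3).comap (Subtype.val : ↥(box 3 N) → Site 3)) hβ a hainj
      (hN N hN₀N a ha) (hSJB _ ((zdGraph 3).comap (Subtype.val : ↥(box 3 N) → Site 3)) (criticalBeta 3) hβ a hainj)
    -- transport to the free box measure of `ℤ³`
    rw [connectedFour_boxComap (box 3 N) (criticalBeta 3) a, twoPoint_boxComap (box 3 N) (criticalBeta 3) (a 0) (a 1),
      twoPoint_boxComap (box 3 N) (criticalBeta 3) (a 2) (a 3)] at hU
    unfold connectedFour at hU
    rw [nPoint_isingMeasure] at hU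
    simp only [twoPoint_eq_isingExpect_spinMonomial] at hU
    -- `(a i : Site 3) = l • x i` definitionally
    have hU' : isingExpect (zdGraph 3) (box 3 N) (criticalBeta 3) 0 .free (spinMonomial fun i : Fin 4 => (l : ℤ) • x i) -
          isingExpect (zdGraph 3) (box 3 N) (criticalBeta 3) 0 .free (spinMonomial ![(l : ℤ) • x 0, (l : ℤ) • x 1]) *
            isingExpect (zdGraph 3) (box 3 N) (criticalBeta 3) 0 .free (spinMonomial ![(l : ℤ) • x 2, (l : ℤ) • x 3]) -
          isingExpect (zdGraph 3) (box 3 N) (criticalBeta 3) 0 .free (spinMonomial ![(l : ℤ) • x 0, (l : ℤ) • x 2]) *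
            isingExpect (zdGraph 3) (box 3 N) (criticalBeta 3) 0 .free (spinMonomial ![(l : ℤ) • x 1, (l : ℤ) • x 3]) -
          isingExpect (zdGraph 3) (box 3 N) (criticalBeta 3) 0 .free (spinMonomial ![(l : ℤ) • x 0, (l : ℤ) • x 3]) *
            isingExpect (zdGraph 3) (box 3 N) (criticalBeta 3) 0 .free (spinMonomial ![(l : ℤ) • x 1, (l : ℤ) • x 2]) ≤
        -(2 * c * (isingExpect (zdGraph 3) (box 3 N) (criticalBeta 3) 0 .free (spinMonomial ![(l : ℤ) • x 0, (l : ℤ) • x 1]) *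
          isingExpect (zdGraph 3) (box 3 N) (criticalBeta 3) 0 .free (spinMonomial ![(l : ℤ) • x 2, (l : ℤ) • x 3]))) := hU
    linarith
  -- the seven free box limits and the closed cone
  have hwd := criticalCorr_wellDefined_holds (d := 3) le_rfl
  have hfree : (BoundaryCondition.free : BoundaryCondition (Site 3)) ∈
      ({.free, .plus, .minus} : Set (BoundaryCondition (Site 3))) := by simp
  have key := tetraDefect_le_of_tendsto' (l := atTop) (c := 2 * c)
    (u₀ := criticalCorr 3 4 (fun i : Fin 4 => (l : ℤ) • x i))
    (g₀ := fun i j => criticalCorr 3 2 ![(l : ℤ) • x i, (l : ℤ) • x j])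
    (g := fun (N : ℕ) (i j : Fin 4) =>
      isingExpect (zdGraph 3) (box 3 N) (criticalBeta 3) 0 .free (spinMonomial ![(l : ℤ) • x i, (l : ℤ) • x j]))
    (hwd 4 (fun i : Fin 4 => (l : ℤ) • x i) .free hfree)
    (hwd 2 ![(l : ℤ) • x 0, (l : ℤ) • x 1] .free hfree) (hwd 2 ![(l : ℤ) • x 2, (l : ℤ) • x 3] .free hfree)
    (hwd 2 ![(l : ℤ) • x 0, (l : ℤ) • x 2] .free hfree) (hwd 2 ![(l : ℤ) • x 1, (l : ℤ) • x 3] .free hfree)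
    (hwd 2 ![(l : ℤ) • x 0, (l : ℤ) • x 3] .free hfree) (hwd 2 ![(l : ℤ) • x 1, (l : ℤ) • x 2] .free hfree)
    (Filter.eventually_atTop.2 ⟨max N₀ l, fun N hN => hfin N hN⟩)
  exact key

/-- **Item `stmt-CriticalPhenomena-14648` — `LatticeBoundFromStrands` holds** (unconditionally, as the
route decl: `IndependentStrandsJoin →` inlined `StrandsJoinBound` `→` the critical lattice `U₄` bound at
the dilated tetrahedra `l·A`, `l ≥ 1`, with constant `2c` from the crux's `c`):
`criticalDefect_le_of_join` at the tetrahedral shape. Axioms: propext, Classical.choice, Quot.sound. -/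
theorem latticeBoundFromStrands_proof : LatticeBoundFromStrands := by
  unfold LatticeBoundFromStrands
  intro hK1 hSJB
  obtain ⟨c, hc, hK⟩ := hK1
  exact ⟨2 * c, by positivity, fun l hl =>
    criticalDefect_le_of_join tetra_injective smul_tetra_mem_box hK hSJB l hl⟩

end StepB

end

end Summit.CriticalPhenomena.Ising3DConformalLimit.FKParityRobustnessLatticeBoundFromStrands
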